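import Summits.CriticalPhenomena.SAWScalingLimit.Theorems.SAWDevelopingMapHexTightReversalDefs

/-!
# Named statements `TravLocalization`, `ArcPinchBound` of the line `reversal-virgin-disc` (crux `HexTight`, stmt-CriticalPhenomena-5423)

Landing target `Summits/CriticalPhenomena/SAWScalingLimit/Theorems/SAWDevelopingMapHexTightPinchDefs.lean`.
Defs-only: the two named `Prop`s of the r5 skeleton
`Cruxes/HexTight/Lines/reversal_virgin_disc.lean` that the two pinch glue stubs (`stub_arcTightOfPinch`,
`stub_rootedTightOfPinch`) take as HYPOTHESES, copied verbatim over the objects of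
`SAWDevelopingMapHexTightReversalDefs.lean` (`IsHArc`, `arcCurve`, `arcMass`, `travMass`, `Straddles`,
`IsVirgin`) so that both glue files share one copy, plus the one termwise API inequality
`travMass_le_arcMass` (the registered sub-goal this file carries). No statement of the line is asserted here.
-/

noncomputable section

open scoped BigOperators Classical
open Literature.Probability.LatticeModels Literature.Probability.RandomPlanarGeometry
  Literature.Probability.RandomPlanarGeometry.SAW

namespace Summit.CriticalPhenomena.SAWScalingLimit.Theorems.HexTight.Reversal

/-- **TRAVERSAL LOCALIZATION** (exact surgery, provable now from `VertexToCurve`; the landed reversal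
recursion `stub_diveRecursion` re-centred and with "`k` separate traversals of `D(y; ρ, R)`" in place of
"dives"). Configuration `(H, Λ₀)` virgin at radius `r₁` about ANY centre `y`; the arc class runs from the
mid-edge `{u, c}` to the mid-edge `{u', c'}` with `u, u' ∉ Λ₀` lattice-adjacent to `c, c'` and BOTH `u, u'`
strictly outside the `r₁`-circle (door-to-door arcs of a bigger disc, or rooted arcs `w → {q, p}` of
`Λ ∖ {p}` with the root far from `y`); shell `D(y; ρ, R)` with `R + 2 ≤ r₁`. If every virgin
sub-configuration `(H, Λ' ⊆ Λ₀)` at `(y, r₁)` with doors `m, m'` has `k`-traversal ratio `≤ θ` for the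
shrunk shell `D(y; ρ + 2, R - 2)`, then the class has `k`-traversal ratio `≤ θ` for `D(y; ρ, R)`. Proof: group
the `H`-arcs having a vertex in `B̄(y, r₁)` by (prefix before the first such vertex, it, the last such
vertex, suffix) exactly as in `stub_diveRecursion` (`diveRecursion_fiber_sum_eq` is weight-generic); on a
group, `k` separate traversals of the glued polyline ⇒ `k` weak vertex traversals of `D(ρ+1, R-1)`
(`vertexTraversals_of_hasTraversals_polyline`, consecutive points `≤ 1` apart) ⇒ the same for the middle
vertex list (`vertexTraversals_middle`: prefix/suffix points are `> r₁ - 1/2 > ρ + 1` from `y`, the cut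
vertices `> r₁ - 1 ≥ R + 1`) ⇒ with the connector's two end mid-points added
(`vertexTraversals_cons_append_singleton`) ⇒ `k` separate traversals of `D(ρ+2, R-2)` by the connector's
polyline (`VertexToCurve`); an arc with `k ≥ 1` traversals has a vertex within `ρ + 1 ≤ r₁` of `y`. -/
def TravLocalization : Prop :=
  ∀ (H : SimpleGraph HexVertex) (Λ₀ : Finset HexVertex) (y : ℂ) (r₁ ρ R θ : ℝ) (k : ℕ)
    (u c u' c' : HexVertex),
    1 ≤ k → 0 ≤ θ → 0 ≤ ρ → ρ + 4 < R → R + 2 ≤ r₁ →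
    u ∉ Λ₀ → u' ∉ Λ₀ → hexGraph.Adj u c → hexGraph.Adj u' c' →
    r₁ < dist (hexCenter u) y → r₁ < dist (hexCenter u') y →
    IsVirgin H Λ₀ y r₁ →
    (∀ (Λ' : Finset HexVertex) (m m' : Sym2 HexVertex), Λ' ⊆ Λ₀ →
        IsVirgin H Λ' y r₁ → Straddles Λ' y r₁ m → Straddles Λ' y r₁ m' →
        travMass H Λ' m m' k y (ρ + 2) (R - 2) ≤ θ * arcMass H Λ' m m') →
    travMass H Λ₀ s(u, c) s(u', c') k y ρ R ≤ θ * arcMass H Λ₀ s(u, c) s(u', c')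

/-- **TWO-STRAND PINCH BOUND** (r5; THE open interior atom; size XL). For SOME exponent `1 + s > 1`:
uniformly over virgin configurations at radius `N ≥ N₀` (arbitrary exterior `Λ, H`; arbitrary doors
`w, w'` on the circle) and `1 ≤ η ≤ N/4`, the arcs whose polyline makes FOUR separate traversals of
`D(z₀; η, N/2)` — two separate strands from outside `B(z₀, N/2)` into the small ball `B̄(z₀, η)` — carry
at most `K (η/N)^{1+s}` of the arc mass. (Aizenman–Burchard (H1) at the fixed threshold `4`; heuristic
exponent `x₄ = 35/12` for the critical `n = 0` model, `> 1` with a wide margin; sub-critically trivially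
true, super-critically false — the atom needs exactly "critical SAW is not dense".) -/
def ArcPinchBound : Prop :=
  ∃ s K N₀ : ℝ, 0 < s ∧ 0 ≤ K ∧ 0 < N₀ ∧
    ∀ (H : SimpleGraph HexVertex) (Λ : Finset HexVertex) (z₀ : ℂ) (η N : ℝ)
      (w w' : Sym2 HexVertex), N₀ ≤ N → 1 ≤ η → η ≤ N / 4 →
      IsVirgin H Λ z₀ N → Straddles Λ z₀ N w → Straddles Λ z₀ N w' →
      travMass H Λ w w' 4 z₀ η (N / 2) ≤ K * (η / N) ^ (1 + s) * arcMass H Λ w w'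

/-- Traversal mass is at most arc mass (termwise: the traversal event only removes terms of a sum of
nonnegative weights). Registered sub-goal `travMass_le_arcMass` of the crux skeleton (the API inequality
this defs file carries; used by both pinch glue stubs). -/
theorem travMass_le_arcMass :
    ∀ (H : SimpleGraph HexVertex) (Λ : Finset HexVertex) (w w' : Sym2 HexVertex) (k : ℕ) (z₀ : ℂ)
      (r R : ℝ), travMass H Λ w w' k z₀ r R ≤ arcMass H Λ w w' := by
  intro H Λ w w' k z₀ r R
  unfold travMass arcMass
  refine Finset.sum_le_sum fun γ _ => ?_
  have hx : 0 ≤ hexCriticalFugacity ^ γ.length := pow_nonneg hexCriticalFugacity_pos_lt_one.1.le _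
  by_cases hA : IsHArc H γ
  · by_cases hB : (arcCurve γ).HasTraversals k z₀ r R
    · rw [if_pos ⟨hA, hB⟩, if_pos hA]
    · rw [if_neg (fun h => hB h.2), if_pos hA]; exact hx
  · rw [if_neg (fun h => hA h.1), if_neg hA]

end Summit.CriticalPhenomena.SAWScalingLimit.Theorems.HexTight.Reversal

end
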